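import Literature.Analysis.Complex.LoewnerMatrixCalculus

/-!
# Loewner's theorem, Part I — Löwner's and Kraus' differential criteria

Second theorem file of the discharge of `Literature.Analysis.Complex.loewner_theorem` (→).
Contents (Hiai–Petz, *Introduction to Matrix Analysis and Applications* (2014), Theorems 4.5 and
4.23 = `[cite: HiaiPetz2014]`; Löwner 1934, Kraus 1936), proved WITHOUT eigenvalue perturbation
theory, by polynomial approximation and the exact expansions of `LoewnerMatrixCalculus`:

* `loewner_matrix_posSemidef` — if `f` is matrix monotone on `Δ ⊇ [c,d]` and `C¹` on `[c,d]`,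
  its Loewner matrices `[f[tᵢ,tⱼ]]` at points of `(c,d)` are positive semidefinite
  (Theorem 4.5, ⇒);
* `qform_aeval_sub_aeval_ge` — the converse for polynomials in approximate form: if the Loewner
  matrices of a polynomial `Q` are `≥ -δ` on `[c,d]`, then `Q(B) - Q(A) ≥ -O(δ)` for
  `A ≤ B` with spectra in `[c,d]` (Theorem 4.5, ⇐, quantitative);
* the elementary API of matrix convexity (`IsMatrixConvexOn`);
* `kraus_qform_ge` — Kraus' necessary condition in sliced, approximate form: matrix convexity of a
  `C²` function `g` forces the second-divided-difference matrices `[Π^{[2]}(λᵢ, 0, λⱼ)]` of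
  `C²`-close polynomials `Π` to be `≥ -O(ε)` (Theorem 4.23 (⇒) at the base point `0`, via the
  bordering construction).

No definitions, no named facts.
-/

noncomputable section

open Finset Matrix Polynomial

namespace Literature.Analysis.Complex

open scoped ComplexOrder MatrixOrder Matrix.Norms.L2Operator
open Set Filter Topology Polynomial

section LoewnerNecessity

/-- **`C¹` Weierstrass approximation**. [folklore] -/
theorem exists_polynomial_C1_near {g g' : ℝ → ℝ} {c d : ℝ} (hcd : c ≤ d)
    (hg : ∀ t ∈ Set.Icc c d, HasDerivAt g (g' t) t) (hg' : ContinuousOn g' (Set.Icc c d))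
    {ε : ℝ} (hε : 0 < ε) :
    ∃ P : ℝ[X], ∀ x ∈ Set.Icc c d, |P.eval x - g x| ≤ ε ∧ |P.derivative.eval x - g' x| ≤ ε := by
  set K : ℝ := max 1 (d - c) with hK
  have hK0 : 0 < K := lt_of_lt_of_le one_pos (le_max_left _ _)
  obtain ⟨q, hq⟩ := exists_polynomial_near_of_continuousOn c d g' hg' (ε / K) (by positivity)
  have hq' : ∀ x ∈ Set.Icc c d, |q.eval x - g' x| ≤ ε / K := fun x hx => (hq x hx).le
  obtain ⟨P, hPd, hP⟩ := exists_polynomial_C1_of_C0 hcd hg hq'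
  refine ⟨P, fun x hx => ⟨?_, ?_⟩⟩
  · calc |P.eval x - g x| ≤ ε / K * (d - c) := hP x hx
      _ = ε * ((d - c) / K) := by ring
      _ ≤ ε * 1 := by gcongr; rw [div_le_one hK0]; exact le_max_right _ _
      _ = ε := mul_one ε
  · rw [hPd]
    calc |q.eval x - g' x| ≤ ε / K := hq' x hx
      _ ≤ ε / 1 := by gcongr; exact le_max_left _ _
      _ = ε := div_one ε

variable {ι : Type*} [Fintype ι] [DecidableEq ι]

/-- The all-ones matrix is dominated by `N • 1` (`N = card ι`), by Cauchy–Schwarz. [folklore] -/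
theorem posSemidef_card_smul_one_sub_ones :
    ((Fintype.card ι : ℂ) • (1 : Matrix ι ι ℂ) - Matrix.of fun _ _ : ι => (1 : ℂ)).PosSemidef := by
  have hJ : (Matrix.of fun _ _ : ι => (1 : ℂ)) =
      Matrix.vecMulVec (fun _ : ι => (1 : ℂ)) (star fun _ : ι => (1 : ℂ)) := by
    ext i j; simp [Matrix.vecMulVec_apply]
  have hherm : ((Fintype.card ι : ℂ) • (1 : Matrix ι ι ℂ) - Matrix.of fun _ _ : ι => (1 : ℂ)).IsHermitian := by
    refine Matrix.IsHermitian.sub ?_ ?_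
    · have : ((Fintype.card ι : ℂ) • (1 : Matrix ι ι ℂ)) = algebraMap ℝ _ (Fintype.card ι : ℝ) := by
        rw [Algebra.algebraMap_eq_smul_one]; simp [real_smul_eq_coe_smul]
      rw [this]
      exact (IsSelfAdjoint.algebraMap (Matrix ι ι ℂ) (IsSelfAdjoint.all (Fintype.card ι : ℝ)) :
        IsSelfAdjoint _)
    · rw [hJ]; exact (Matrix.posSemidef_vecMulVec_self_star _).1
  rw [posSemidef_iff_qform hherm]
  intro w
  rw [qform_sub]
  -- qform (N • 1) w = N ∑ |w_a|² and qform J w = |∑ w_a|²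
  have h1 : qform ((Fintype.card ι : ℂ) • (1 : Matrix ι ι ℂ)) w = Fintype.card ι * ∑ a, ‖w a‖ ^ 2 := by
    rw [show ((Fintype.card ι : ℂ)) = ((Fintype.card ι : ℝ) : ℂ) by simp, qform_smul]
    congr 1
    simp only [qform, Matrix.one_mulVec, dotProduct, Pi.star_apply, Complex.re_sum]
    refine Finset.sum_congr rfl fun a _ => ?_
    rw [Complex.star_def, ← Complex.normSq_eq_conj_mul_self, Complex.normSq_eq_norm_sq]
    norm_cast
  have h2 : qform (Matrix.of fun _ _ : ι => (1 : ℂ)) w = ‖∑ a, w a‖ ^ 2 := by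
    simp only [qform, dotProduct, Matrix.mulVec, Matrix.of_apply, one_mul, Pi.star_apply]
    rw [← Finset.sum_mul, show (∑ a, star (w a)) = star (∑ a, w a) by rw [star_sum],
      Complex.star_def, ← Complex.normSq_eq_conj_mul_self, Complex.normSq_eq_norm_sq]
    norm_cast
  rw [h1, h2, sub_nonneg]
  -- Cauchy–Schwarz
  calc ‖∑ a, w a‖ ^ 2 ≤ (∑ a, ‖w a‖) ^ 2 := by gcongr; exact norm_sum_le _ _
    _ = (∑ a, ‖w a‖ * 1) ^ 2 := by simp
    _ ≤ (∑ a, ‖w a‖ ^ 2) * ∑ _a : ι, (1 : ℝ) ^ 2 := Finset.sum_mul_sq_le_sq_mul_sq _ _ _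
    _ = Fintype.card ι * ∑ a, ‖w a‖ ^ 2 := by simp [mul_comm]

omit [DecidableEq ι] in
/-- Entrywise size of the all-ones matrix. [folklore] -/
theorem entrySum_ones : entrySum (Matrix.of fun _ _ : ι => (1 : ℂ)) = (Fintype.card ι : ℝ) ^ 2 := by
  simp [entrySum, sq]

/-- `f = P + (f - P)` splits `cfc f` into a matrix polynomial and a small remainder. [folklore] -/
theorem cfc_eq_aeval_add_cfc_sub {X : Matrix ι ι ℂ} (hX : X.IsHermitian) (f : ℝ → ℝ) (P : ℝ[X]) :
    cfc f X = aeval X P + cfc (fun x => f x - P.eval x) X := by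
  have hX' : IsSelfAdjoint X := hX
  have hc : ∀ g : ℝ → ℝ, ContinuousOn g (spectrum ℝ X) := fun g =>
    (Matrix.finite_real_spectrum (A := X)).continuousOn g
  have : f = fun x => P.eval x + (f x - P.eval x) := by funext x; ring
  conv_lhs => rw [this]
  rw [cfc_add X _ _ (hc _) (hc _), cfc_polynomial P X hX']

omit [Fintype ι] [DecidableEq ι] in
/-- Real symmetric matrices given by symmetric real kernels are Hermitian. [folklore] -/
theorem isHermitian_of_real_symm {L : ι → ι → ℝ} (hL : ∀ i j, L i j = L j i) :
    (Matrix.of fun i j => (L i j : ℂ)).IsHermitian := by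
  ext i j
  simp [Matrix.conjTranspose_apply, hL i j]

/-- **Loewner matrices of a smooth matrix monotone function are positive semidefinite**
(Löwner 1934; Hiai–Petz, *Introduction to Matrix Analysis*, Thm 4.5 (⇒)), proved without
perturbation theory: `f(D + sJ) - f(D) ⪰ 0` for `D = diag t`, `J` the all-ones matrix; splitting
`f = P + φ` with `P` a `C¹`-close polynomial, the first-order term of the polynomial part is the
Hadamard product `L_P(t) ⊙ J = L_P(t)` (Daleckii–Krein for polynomials) while the remainder is
`O(s · sup |φ'|)` entrywise (Lemma A). [cite: Loewner1934, Satz (Part I, necessity)] -/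
theorem loewner_matrix_posSemidef {f f' : ℝ → ℝ} {Δ : Set ℝ} (h : IsMatrixMonotoneOn f Δ)
    {c d : ℝ} (hΔ : Set.Icc c d ⊆ Δ) (hf : ∀ t ∈ Set.Icc c d, HasDerivAt f (f' t) t)
    (hf' : ContinuousOn f' (Set.Icc c d)) (t : ι → ℝ) (ht : ∀ i, t i ∈ Set.Ioo c d) :
    (Matrix.of fun i j => (dd1 f (t i) (t j) : ℂ)).PosSemidef := by
  -- trivial when `ι` is empty
  rcases isEmpty_or_nonempty ι with hι | hι
  · refine ⟨isHermitian_of_real_symm fun i j => dd1_comm f (t i) (t j), fun x => ?_⟩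
    simp [Finsupp.sum, Finset.eq_empty_of_isEmpty]
  have hcd : c ≤ d := by
    obtain ⟨i⟩ := hι; exact ((ht i).1.trans (ht i).2).le
  -- notation
  set N : ℕ := Fintype.card ι with hN
  have hN1 : (1 : ℝ) ≤ N := by
    have : 0 < Fintype.card ι := Fintype.card_pos
    exact_mod_cast this
  set D : Matrix ι ι ℂ := Matrix.diagonal fun i => ((t i : ℝ) : ℂ) with hD
  set J : Matrix ι ι ℂ := Matrix.of fun _ _ : ι => (1 : ℂ) with hJ
  have hDh : D.IsHermitian := Matrix.isHermitian_diagonal_of_self_adjoint _ (funext fun i => by simp)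
  have hJp : J.PosSemidef := by
    have : J = Matrix.vecMulVec (fun _ : ι => (1 : ℂ)) (star fun _ : ι => (1 : ℂ)) := by
      ext i j; simp [hJ, Matrix.vecMulVec_apply]
    rw [this]; exact Matrix.posSemidef_vecMulVec_self_star _
  -- margins
  set tmax : ℝ := Finset.univ.sup' Finset.univ_nonempty t with htmax
  have htle : ∀ i, t i ≤ tmax := fun i => Finset.le_sup' t (Finset.mem_univ i)
  have htmax_lt : tmax < d := by
    obtain ⟨i, _, hi⟩ := Finset.exists_mem_eq_sup' Finset.univ_nonempty t
    rw [htmax, hi]; exact (ht i).2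
  set η : ℝ := (d - tmax) / 2 with hη
  have hη0 : 0 < η := by rw [hη]; linarith
  set s₀ : ℝ := η / N with hs₀
  have hs₀0 : 0 < s₀ := by positivity
  -- spectra along the perturbation
  have hspecD : spectrum ℝ D ⊆ Set.Icc c d := by
    rw [hD, spectrum_real_diagonal]
    rintro _ ⟨i, rfl⟩
    exact ⟨(ht i).1.le, (ht i).2.le⟩
  have hXh : ∀ s : ℝ, (D + (s : ℂ) • J).IsHermitian := fun s => by
    refine hDh.add ?_
    have : ((s : ℂ) • J) = (s : ℝ) • J := (real_smul_eq_coe_smul s J).symm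
    rw [this]
    exact (IsSelfAdjoint.smul (IsSelfAdjoint.all s) (show IsSelfAdjoint J from hJp.1) : IsSelfAdjoint _)
  have hspecX : ∀ s : ℝ, 0 < s → s ≤ s₀ → spectrum ℝ (D + (s : ℂ) • J) ⊆ Set.Icc c d := by
    intro s hs0 hs1
    refine spectrum_subset_Icc_of_le_of_le (hXh s) ?_ ?_
    · -- lower bound: (D - c) + sJ ⪰ 0
      obtain ⟨hDc, -⟩ := le_and_le_of_spectrum_subset hDh hspecD
      have : D + (s : ℂ) • J - algebraMap ℝ (Matrix ι ι ℂ) c =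
          (D - algebraMap ℝ (Matrix ι ι ℂ) c) + (s : ℂ) • J := by abel
      rw [this]
      exact hDc.add (hJp.smul (by exact_mod_cast hs0.le))
    · -- upper bound: d - D - sJ = (d - tmax - sN)•1 + (tmax•1 - D) + s (N•1 - J)
      have hDt : (algebraMap ℝ (Matrix ι ι ℂ) tmax - D).PosSemidef := by
        obtain ⟨-, h2⟩ := le_and_le_of_spectrum_subset hDh (a := c) (b := tmax) (by
          rw [hD, spectrum_real_diagonal]
          rintro _ ⟨i, rfl⟩
          exact ⟨(ht i).1.le, htle i⟩)
        exact h2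
      have hcoef : 0 ≤ d - tmax - s * N := by
        have : s * N ≤ s₀ * N := by gcongr
        rw [hs₀, div_mul_cancel₀ _ (by positivity)] at this
        rw [hη] at this; linarith
      have hdecomp : algebraMap ℝ (Matrix ι ι ℂ) d - (D + (s : ℂ) • J) =
          algebraMap ℝ (Matrix ι ι ℂ) (d - tmax - s * N) + (algebraMap ℝ (Matrix ι ι ℂ) tmax - D) +
            (s : ℂ) • ((N : ℂ) • (1 : Matrix ι ι ℂ) - J) := by
        rw [Algebra.algebraMap_eq_smul_one, Algebra.algebraMap_eq_smul_one,
          Algebra.algebraMap_eq_smul_one]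
        simp only [real_smul_eq_coe_smul]
        push_cast
        module
      rw [hdecomp]
      refine (Matrix.PosSemidef.add ?_ hDt).add ?_
      · rw [Algebra.algebraMap_eq_smul_one, real_smul_eq_coe_smul]
        exact Matrix.PosSemidef.one.smul (by exact_mod_cast hcoef)
      · exact posSemidef_card_smul_one_sub_ones.smul (by exact_mod_cast hs0.le)
  -- Step 1: monotonicity gives `f(D + sJ) - f(D) ⪰ 0`
  have hmono : ∀ s : ℝ, 0 < s → s ≤ s₀ → (cfc f (D + (s : ℂ) • J) - cfc f D).PosSemidef := by
    intro s hs0 hs1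
    refine h.posSemidef_of_fintype hDh (hXh s) (hspecD.trans hΔ) ((hspecX s hs0 hs1).trans hΔ) ?_
    rw [add_sub_cancel_left]
    exact hJp.smul (by exact_mod_cast hs0.le)
  -- Step 2: the Loewner matrix is Hermitian; reduce to quadratic forms
  have hLh : (Matrix.of fun i j => (dd1 f (t i) (t j) : ℂ)).IsHermitian :=
    isHermitian_of_real_symm fun i j => dd1_comm f (t i) (t j)
  rw [posSemidef_iff_qform hLh]
  intro w
  set W : ℝ := ∑ a, ‖w a‖ ^ 2 with hW
  have hW0 : 0 ≤ W := Finset.sum_nonneg fun _ _ => by positivity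
  -- Step 3: for every ε > 0, qform L w ≥ -(N^6 + N^2) ε W
  suffices key : ∀ ε : ℝ, 0 < ε → -((N : ℝ) ^ 6 + (N : ℝ) ^ 2) * ε * W ≤
      qform (Matrix.of fun i j => (dd1 f (t i) (t j) : ℂ)) w by
    set q : ℝ := qform (Matrix.of fun i j => (dd1 f (t i) (t j) : ℂ)) w with hq
    set C : ℝ := ((N : ℝ) ^ 6 + (N : ℝ) ^ 2) * W with hC
    have hC0 : 0 ≤ C := by positivity
    by_contra hneg
    push Not at hneg
    have hε : 0 < -q / (C + 1) := div_pos (by linarith) (by linarith)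
    have h1 := key _ hε
    have h2 : -((N : ℝ) ^ 6 + (N : ℝ) ^ 2) * (-q / (C + 1)) * W = C * q / (C + 1) := by
      rw [hC]; field_simp
    rw [h2, div_le_iff₀ (by linarith)] at h1
    nlinarith
  intro ε hε
  -- Step 4: a `C¹`-close polynomial
  obtain ⟨P, hP⟩ := exists_polynomial_C1_near hcd hf hf' hε
  set φ : ℝ → ℝ := fun x => f x - P.eval x with hφ
  have hφd : ∀ x ∈ Set.Icc c d, HasDerivAt φ (f' x - P.derivative.eval x) x := fun x hx =>
    (hf x hx).sub (P.hasDerivAt x)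
  have hφb : ∀ x ∈ Set.Icc c d, |deriv φ x| ≤ ε := by
    intro x hx
    rw [(hφd x hx).deriv, abs_sub_comm]
    exact (hP x hx).2
  have hdd1φ : ∀ x ∈ Set.Icc c d, ∀ y ∈ Set.Icc c d, |dd1 φ x y| ≤ ε := fun x hx y hy =>
    abs_dd1_le (fun u hu => (hφd u hu).differentiableAt) hφb hx hy
  -- Step 5: the remainder is small: entrySum ≤ N⁶ ε s
  have hrem : ∀ s : ℝ, 0 < s → s ≤ s₀ →
      entrySum (cfc φ (D + (s : ℂ) • J) - cfc φ D) ≤ (N : ℝ) ^ 6 * ε * s := by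
    intro s hs0 hs1
    have hev : ∀ i k, |dd1 φ ((hXh s).eigenvalues i) (hDh.eigenvalues k)| ≤ ε := fun i k =>
      hdd1φ _ (hspecX s hs0 hs1 ((hXh s).eigenvalues_mem_spectrum_real i)) _
        (hspecD (hDh.eigenvalues_mem_spectrum_real k))
    have := entrySum_cfc_sub_cfc_le (hXh s) hDh φ (fun a b => dd1_mul_sub φ a b) hε.le hev
    rw [add_sub_cancel_left, entrySum_smul, entrySum_ones, Complex.norm_real, Real.norm_eq_abs,
      abs_of_pos hs0] at this
    calc entrySum (cfc φ (D + (s : ℂ) • J) - cfc φ D) ≤ (N : ℝ) ^ 4 * ε * (s * (N : ℝ) ^ 2) := this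
      _ = (N : ℝ) ^ 6 * ε * s := by ring
  -- Step 6: hence the polynomial slope has quadratic form ≥ -N⁶ ε W for small s > 0
  have hslope : ∀ s : ℝ, 0 < s → s ≤ s₀ →
      -((N : ℝ) ^ 6 * ε * W) ≤ qform (s⁻¹ • (aeval (D + (s : ℂ) • J) P - aeval D P)) w := by
    intro s hs0 hs1
    have hsplit : cfc f (D + (s : ℂ) • J) - cfc f D =
        (aeval (D + (s : ℂ) • J) P - aeval D P) + (cfc φ (D + (s : ℂ) • J) - cfc φ D) := by
      rw [cfc_eq_aeval_add_cfc_sub (hXh s) f P, cfc_eq_aeval_add_cfc_sub hDh f P]; abel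
    have h0 : 0 ≤ qform (cfc f (D + (s : ℂ) • J) - cfc f D) w := qform_nonneg_of_posSemidef (hmono s hs0 hs1) w
    rw [hsplit, qform_add] at h0
    have h1 : qform (cfc φ (D + (s : ℂ) • J) - cfc φ D) w ≤ (N : ℝ) ^ 6 * ε * s * W :=
      (qform_le _ w).trans (by rw [hW]; gcongr; exact hrem s hs0 hs1)
    rw [qform_real_smul]
    rw [le_inv_mul_iff₀ hs0]
    nlinarith
  -- Step 7: pass to the limit `s → 0⁺`
  have hder := hasDerivAt_aeval_add_smul D J P
  rw [hasDerivAt_iff_tendsto_slope_zero] at hder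
  have hlim : Tendsto (fun s : ℝ => qform (s⁻¹ • (aeval (D + (s : ℂ) • J) P - aeval D P)) w)
      (𝓝[>] 0) (𝓝 (qform (polyCoeff D J P 1) w)) := by
    have h1 : Tendsto (fun s : ℝ => s⁻¹ • (aeval (D + (s : ℂ) • J) P - aeval D P)) (𝓝[≠] 0)
        (𝓝 (polyCoeff D J P 1)) := by
      refine hder.congr' ?_
      filter_upwards with s
      simp
    exact ((continuous_qform w).tendsto _).comp (h1.mono_left (nhdsWithin_mono _ fun s hs => ne_of_gt hs))
  have hev : ∀ᶠ (s : ℝ) in 𝓝[>] (0 : ℝ),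
      -((N : ℝ) ^ 6 * ε * W) ≤ qform (s⁻¹ • (aeval (D + (s : ℂ) • J) P - aeval D P)) w := by
    filter_upwards [Ioo_mem_nhdsGT hs₀0] with s hs
    exact hslope s hs.1 hs.2.le
  have hpc : -((N : ℝ) ^ 6 * ε * W) ≤ qform (polyCoeff D J P 1) w := ge_of_tendsto hlim hev
  -- Step 8: `polyCoeff D J P 1 = L_P(t)` and `L_P(t)` is `ε`-close to `L_f(t)` entrywise
  have hclose : entrySum (polyCoeff D J P 1 - Matrix.of fun i j => (dd1 f (t i) (t j) : ℂ)) ≤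
      (N : ℝ) ^ 2 * ε := by
    have hentry : ∀ i j, ‖(polyCoeff D J P 1 - Matrix.of fun i j => (dd1 f (t i) (t j) : ℂ)) i j‖ ≤ ε := by
      intro i j
      rw [Matrix.sub_apply, hD, polyCoeff_one_apply, hJ, Matrix.of_apply, Matrix.of_apply, mul_one,
        ← Complex.ofReal_sub, Complex.norm_real, Real.norm_eq_abs]
      have hti : t i ∈ Set.Icc c d := ⟨(ht i).1.le, (ht i).2.le⟩
      have htj : t j ∈ Set.Icc c d := ⟨(ht j).1.le, (ht j).2.le⟩
      by_cases hij : t i = t j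
      · rw [hij, polyDD1_self, dd1_self, (hf _ htj).deriv]
        exact (hP _ htj).2
      · -- both are slopes
        have e1 := polyDD1_mul_sub P (t i) (t j)
        have e2 := dd1_mul_sub f (t i) (t j)
        have e3 := dd1_mul_sub φ (t i) (t j)
        have hne : t i - t j ≠ 0 := sub_ne_zero.mpr hij
        have : polyDD1 P (t i) (t j) - dd1 f (t i) (t j) = -dd1 φ (t i) (t j) := by
          apply mul_right_cancel₀ hne
          rw [sub_mul, e1, e2, neg_mul, e3]
          simp only [hφ]; ring
        rw [this, abs_neg]
        exact hdd1φ _ hti _ htj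
    calc entrySum (polyCoeff D J P 1 - Matrix.of fun i j => (dd1 f (t i) (t j) : ℂ))
        = ∑ i, ∑ j, ‖(polyCoeff D J P 1 - Matrix.of fun i j => (dd1 f (t i) (t j) : ℂ)) i j‖ := rfl
      _ ≤ ∑ _i : ι, ∑ _j : ι, ε := Finset.sum_le_sum fun i _ => Finset.sum_le_sum fun j _ => hentry i j
      _ = (N : ℝ) ^ 2 * ε := by simp [hN, sq]; ring
  have hfin : qform (Matrix.of fun i j => (dd1 f (t i) (t j) : ℂ)) w =
      qform (polyCoeff D J P 1) w -
        qform (polyCoeff D J P 1 - Matrix.of fun i j => (dd1 f (t i) (t j) : ℂ)) w := by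
    rw [qform_sub]; ring
  rw [hfin]
  have h3 := qform_le (polyCoeff D J P 1 - Matrix.of fun i j => (dd1 f (t i) (t j) : ℂ)) w
  rw [← hW] at h3
  nlinarith [h3, hpc, hclose, hW0]

end LoewnerNecessity

end Literature.Analysis.Complex

namespace Literature.Analysis.Complex

open scoped ComplexOrder MatrixOrder Matrix.Norms.L2Operator
open Set Filter Topology Polynomial

section LoewnerSufficiency

variable {ι : Type*} [Fintype ι] [DecidableEq ι]

omit [DecidableEq ι] in
/-- Conjugation moves into the vector of a quadratic form. [folklore] -/
theorem qform_conj (U M : Matrix ι ι ℂ) (w : ι → ℂ) :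
    qform (U * M * star U) w = qform M (star U *ᵥ w) := by
  unfold qform
  rw [← Matrix.mulVec_mulVec, ← Matrix.mulVec_mulVec, Matrix.dotProduct_mulVec]
  congr 2
  rw [Matrix.star_mulVec, Matrix.star_eq_conjTranspose, Matrix.conjTranspose_conjTranspose]

omit [DecidableEq ι] in
/-- The squared norm of a vector as a real quadratic form. [folklore] -/
theorem sum_norm_sq_eq_re (v : ι → ℂ) : ∑ a, ‖v a‖ ^ 2 = (star v ⬝ᵥ v).re := by
  simp only [dotProduct, Pi.star_apply, Complex.re_sum]
  refine Finset.sum_congr rfl fun a _ => ?_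
  rw [Complex.star_def, ← Complex.normSq_eq_conj_mul_self, Complex.normSq_eq_norm_sq]
  norm_cast

/-- Unitaries preserve `∑ ‖w_a‖²`. [folklore] -/
theorem sum_norm_sq_star_mulVec {U : Matrix ι ι ℂ} (hU : U * star U = 1) (w : ι → ℂ) :
    ∑ a, ‖(star U *ᵥ w) a‖ ^ 2 = ∑ a, ‖w a‖ ^ 2 := by
  rw [sum_norm_sq_eq_re, sum_norm_sq_eq_re, Matrix.star_mulVec, Matrix.star_eq_conjTranspose,
    Matrix.conjTranspose_conjTranspose, ← Matrix.dotProduct_mulVec, Matrix.mulVec_mulVec,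
    ← Matrix.star_eq_conjTranspose, hU, Matrix.one_mulVec]

omit [DecidableEq ι] in
/-- Auxiliary for the proof of Loewner's theorem (`qform_one_smul`: qform one smul). [folklore] -/
theorem qform_one_smul (δ : ℝ) (v : ι → ℂ) [DecidableEq ι] :
    qform ((δ : ℂ) • (1 : Matrix ι ι ℂ)) v = δ * ∑ a, ‖v a‖ ^ 2 := by
  rw [qform_smul, sum_norm_sq_eq_re]
  simp [qform]

/-- **Schur product with an almost positive matrix**: if `L` is Hermitian with `L ⪰ -δ` and
`H ⪰ 0` then `L ⊙ H ⪰ -δ · entrySum H`. [folklore] -/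
theorem qform_hadamard_ge {L H : Matrix ι ι ℂ} (hL : L.IsHermitian) {δ : ℝ} (hδ : 0 ≤ δ)
    (hLq : ∀ v : ι → ℂ, -(δ * ∑ a, ‖v a‖ ^ 2) ≤ qform L v) (hH : H.PosSemidef) (v : ι → ℂ) :
    -(δ * entrySum H * ∑ a, ‖v a‖ ^ 2) ≤ qform (L ⊙ H) v := by
  -- `L + δ ⪰ 0`
  have hLd : (L + (δ : ℂ) • (1 : Matrix ι ι ℂ)).PosSemidef := by
    have hh : (L + (δ : ℂ) • (1 : Matrix ι ι ℂ)).IsHermitian := by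
      refine hL.add ?_
      rw [← real_smul_eq_coe_smul]
      exact (IsSelfAdjoint.smul (IsSelfAdjoint.all δ) (IsSelfAdjoint.one (Matrix ι ι ℂ)) :
        IsSelfAdjoint _)
    rw [posSemidef_iff_qform hh]
    intro u
    rw [qform_add, qform_one_smul]
    linarith [hLq u]
  have hSchur := hLd.hadamard hH
  have h0 := qform_nonneg_of_posSemidef hSchur v
  rw [Matrix.add_hadamard, qform_add] at h0
  -- the correction term is at most `δ entrySum H ∑ |v|²`
  have hcorr : qform (((δ : ℂ) • (1 : Matrix ι ι ℂ)) ⊙ H) v ≤ δ * entrySum H * ∑ a, ‖v a‖ ^ 2 := by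
    have : ((δ : ℂ) • (1 : Matrix ι ι ℂ)) ⊙ H = (δ : ℂ) • ((1 : Matrix ι ι ℂ) ⊙ H) := by
      rw [Matrix.smul_hadamard]
    rw [this, qform_smul, mul_assoc]
    refine mul_le_mul_of_nonneg_left ?_ hδ
    have hle : entrySum ((1 : Matrix ι ι ℂ) ⊙ H) ≤ entrySum H := by
      unfold entrySum
      refine Finset.sum_le_sum fun a _ => Finset.sum_le_sum fun b _ => ?_
      rw [Matrix.hadamard_apply, norm_mul, Matrix.one_apply]
      split_ifs <;> simp
    have hW : 0 ≤ ∑ a, ‖v a‖ ^ 2 := Finset.sum_nonneg fun _ _ => by positivity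
    exact (qform_le _ v).trans (mul_le_mul_of_nonneg_right hle hW)
  linarith

/-- Spectra along the segment `A + s (B - A)`. [folklore] -/
theorem spectrum_segment_subset {A B : Matrix ι ι ℂ} (hA : A.IsHermitian) (hB : B.IsHermitian)
    {c d : ℝ} (hAs : spectrum ℝ A ⊆ Set.Icc c d) (hBs : spectrum ℝ B ⊆ Set.Icc c d) {s : ℝ}
    (hs0 : 0 ≤ s) (hs1 : s ≤ 1) : spectrum ℝ (A + (s : ℂ) • (B - A)) ⊆ Set.Icc c d := by
  have hh : (A + (s : ℂ) • (B - A)).IsHermitian := by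
    refine hA.add ?_
    rw [← real_smul_eq_coe_smul]
    exact (IsSelfAdjoint.smul (IsSelfAdjoint.all s) (hB.sub hA : IsSelfAdjoint _) : IsSelfAdjoint _)
  obtain ⟨hAc, hAd⟩ := le_and_le_of_spectrum_subset hA hAs
  obtain ⟨hBc, hBd⟩ := le_and_le_of_spectrum_subset hB hBs
  refine spectrum_subset_Icc_of_le_of_le hh ?_ ?_
  · have : A + (s : ℂ) • (B - A) - algebraMap ℝ (Matrix ι ι ℂ) c =
        ((1 - s : ℝ) : ℂ) • (A - algebraMap ℝ (Matrix ι ι ℂ) c) +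
          (s : ℂ) • (B - algebraMap ℝ (Matrix ι ι ℂ) c) := by
      push_cast; module
    rw [this]
    exact (hAc.smul (by exact_mod_cast (sub_nonneg.mpr hs1))).add (hBc.smul (by exact_mod_cast hs0))
  · have : algebraMap ℝ (Matrix ι ι ℂ) d - (A + (s : ℂ) • (B - A)) =
        ((1 - s : ℝ) : ℂ) • (algebraMap ℝ (Matrix ι ι ℂ) d - A) +
          (s : ℂ) • (algebraMap ℝ (Matrix ι ι ℂ) d - B) := by
      push_cast; module
    rw [this]
    exact (hAd.smul (by exact_mod_cast (sub_nonneg.mpr hs1))).add (hBd.smul (by exact_mod_cast hs0))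

omit [DecidableEq ι] in
/-- Auxiliary for the proof of Loewner's theorem (`qformL_apply`: qformL apply). [folklore] -/
@[simp] theorem qformL_apply (w : ι → ℂ) (M : Matrix ι ι ℂ) : qformL w M = qform M w := rfl

/-- **Derivative of the quadratic form of a matrix polynomial along a segment.** [folklore] -/
theorem hasDerivAt_qform_aeval_segment (A H : Matrix ι ι ℂ) (Q : ℝ[X]) (w : ι → ℂ) (s₀ : ℝ) :
    HasDerivAt (fun s : ℝ => qform (aeval (A + (s : ℂ) • H) Q) w)
      (qform (polyCoeff (A + (s₀ : ℂ) • H) H Q 1) w) s₀ := by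
  have hF := hasDerivAt_aeval_add_smul (A + (s₀ : ℂ) • H) H Q
  -- shift the base point
  have hshift : HasDerivAt (fun s : ℝ => aeval (A + (s : ℂ) • H) Q)
      (polyCoeff (A + (s₀ : ℂ) • H) H Q 1) s₀ := by
    have h1 : HasDerivAt (fun s : ℝ => s - s₀) 1 s₀ := (hasDerivAt_id s₀).sub_const s₀
    have hF' : HasDerivAt (fun u : ℝ => aeval (A + (s₀ : ℂ) • H + (u : ℂ) • H) Q)
        (polyCoeff (A + (s₀ : ℂ) • H) H Q 1) ((fun s : ℝ => s - s₀) s₀) := by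
      rw [show (fun s : ℝ => s - s₀) s₀ = 0 by simp]; exact hF
    have h2 := HasDerivAt.scomp (𝕜 := ℝ) (h := fun s : ℝ => s - s₀) s₀ hF' h1
    rw [one_smul] at h2
    refine h2.congr_of_eventuallyEq (Eventually.of_forall fun s => ?_)
    have : A + (s₀ : ℂ) • H + ((s - s₀ : ℝ) : ℂ) • H = A + (s : ℂ) • H := by push_cast; module
    simp only [Function.comp_apply, this]
  exact (qformL w).hasFDerivAt.comp_hasDerivAt s₀ hshift

/-- The algebraic Loewner matrix of a polynomial is Hermitian (real symmetric). [folklore] -/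
theorem polyDD1_comm (Q : ℝ[X]) (x y : ℝ) : polyDD1 Q x y = polyDD1 Q y x := by
  simp only [polyDD1, Polynomial.sum, pdd1_comm]

/-- **Approximate Loewner criterion for polynomials** (Hiai–Petz Thm 4.5 (⇐), quantitative
form): if the algebraic Loewner matrices `L_Q(λ)` of a real polynomial `Q` satisfy
`L_Q(λ) ⪰ -δ` for all `λ ∈ [c,d]ⁿ`, then for Hermitian `A ≤ B` with spectra in `[c,d]`,
`Q(B) - Q(A) ⪰ -δ n² · entrySum (B - A)`. Proof: along `A_s = A + s(B-A)` the derivative of the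
quadratic form is a quadratic form of `L_Q(λ(A_s)) ⊙ (U⋆(B-A)U)` (Daleckii–Krein for
polynomials in the eigenbasis of `A_s`), controlled by the Schur product theorem. [folklore] -/
theorem qform_aeval_sub_aeval_ge {Q : ℝ[X]} {c d δ : ℝ} (hδ : 0 ≤ δ)
    (hL : ∀ lam : ι → ℝ, (∀ i, lam i ∈ Set.Icc c d) → ∀ v : ι → ℂ,
      -(δ * ∑ a, ‖v a‖ ^ 2) ≤ qform (Matrix.of fun i j => (polyDD1 Q (lam i) (lam j) : ℂ)) v)
    {A B : Matrix ι ι ℂ} (hA : A.IsHermitian) (hB : B.IsHermitian)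
    (hAs : spectrum ℝ A ⊆ Set.Icc c d) (hBs : spectrum ℝ B ⊆ Set.Icc c d)
    (hAB : (B - A).PosSemidef) (w : ι → ℂ) :
    -(δ * ((Fintype.card ι : ℝ) ^ 2 * entrySum (B - A)) * ∑ a, ‖w a‖ ^ 2) ≤
      qform (aeval B Q - aeval A Q) w := by
  set H := B - A with hH
  set γ : ℝ → ℝ := fun s => qform (aeval (A + (s : ℂ) • H) Q) w with hγ
  set K : ℝ := δ * ((Fintype.card ι : ℝ) ^ 2 * entrySum H) * ∑ a, ‖w a‖ ^ 2 with hK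
  -- derivative bound along the segment
  have hderiv : ∀ s ∈ Set.Icc (0 : ℝ) 1, HasDerivAt γ (qform (polyCoeff (A + (s : ℂ) • H) H Q 1) w) s ∧
      -K ≤ qform (polyCoeff (A + (s : ℂ) • H) H Q 1) w := by
    intro s hs
    refine ⟨hasDerivAt_qform_aeval_segment A H Q w s, ?_⟩
    -- diagonalise `A_s`
    set As := A + (s : ℂ) • H with hAsdef
    have hAsh : As.IsHermitian := by
      refine hA.add ?_
      rw [← real_smul_eq_coe_smul]
      exact (IsSelfAdjoint.smul (IsSelfAdjoint.all s) (hB.sub hA : IsSelfAdjoint _) : IsSelfAdjoint _)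
    set U : Matrix ι ι ℂ := (hAsh.eigenvectorUnitary : Matrix ι ι ℂ) with hU
    have hUu : star U * U = 1 := Unitary.coe_star_mul_self hAsh.eigenvectorUnitary
    have hUu' : U * star U = 1 := Unitary.coe_mul_star_self hAsh.eigenvectorUnitary
    set Λ : Matrix ι ι ℂ := Matrix.diagonal fun i => ((hAsh.eigenvalues i : ℝ) : ℂ) with hΛ
    have hspec : As = U * Λ * star U := by
      conv_lhs => rw [hAsh.spectral_theorem, Unitary.conjStarAlgAut_apply]
      rfl
    set Ht : Matrix ι ι ℂ := star U * H * U with hHt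
    have hHexp : H = U * Ht * star U := by
      rw [hHt, show U * (star U * H * U) * star U = (U * star U) * H * (U * star U) by
        simp only [Matrix.mul_assoc], hUu', Matrix.one_mul, Matrix.mul_one]
    have hpc : polyCoeff As H Q 1 = U * polyCoeff Λ Ht Q 1 * star U := by
      conv_lhs => rw [hspec, hHexp]
      exact polyCoeff_conj hUu Λ Ht Q 1
    have hpc1 : polyCoeff Λ Ht Q 1 =
        Matrix.of (fun i j => (polyDD1 Q (hAsh.eigenvalues i) (hAsh.eigenvalues j) : ℂ)) ⊙ Ht := by
      ext i j
      rw [hΛ, polyCoeff_one_apply, Matrix.hadamard_apply, Matrix.of_apply]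
    rw [hpc, qform_conj, hpc1]
    -- Schur
    have hev : ∀ i, hAsh.eigenvalues i ∈ Set.Icc c d := fun i =>
      spectrum_segment_subset hA hB hAs hBs hs.1 hs.2 (hAsh.eigenvalues_mem_spectrum_real i)
    have hLh : (Matrix.of fun i j =>
        (polyDD1 Q (hAsh.eigenvalues i) (hAsh.eigenvalues j) : ℂ)).IsHermitian :=
      isHermitian_of_real_symm fun i j => polyDD1_comm Q _ _
    have hHtp : Ht.PosSemidef := by
      rw [hHt, show star U = (U)ᴴ from rfl]
      exact hAB.conjTranspose_mul_mul_same U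
    have h1 := qform_hadamard_ge hLh hδ (hL _ hev) hHtp (star U *ᵥ w)
    rw [sum_norm_sq_star_mulVec hUu'] at h1
    refine le_trans ?_ h1
    rw [hK, neg_le_neg_iff]
    have hW : 0 ≤ ∑ a, ‖w a‖ ^ 2 := Finset.sum_nonneg fun _ _ => by positivity
    have hHt_le : entrySum Ht ≤ (Fintype.card ι : ℝ) ^ 2 * entrySum H :=
      entrySum_mul_mul_le (norm_star_eigenvectorUnitary_apply_le hAsh)
        (norm_eigenvectorUnitary_apply_le hAsh) H
    gcongr
  -- mean value inequality on `[0, 1]`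
  have hcont : ContinuousOn γ (Set.Icc 0 1) := fun s hs => (hderiv s hs).1.continuousAt.continuousWithinAt
  have hdiff : DifferentiableOn ℝ γ (interior (Set.Icc (0 : ℝ) 1)) := by
    rw [interior_Icc]; exact fun s hs => (hderiv s (Ioo_subset_Icc_self hs)).1.differentiableAt.differentiableWithinAt
  have hge : ∀ s ∈ interior (Set.Icc (0 : ℝ) 1), -K ≤ deriv γ s := by
    rw [interior_Icc]; intro s hs
    rw [(hderiv s (Ioo_subset_Icc_self hs)).1.deriv]
    exact (hderiv s (Ioo_subset_Icc_self hs)).2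
  have hmv := (convex_Icc (0 : ℝ) 1).mul_sub_le_image_sub_of_le_deriv hcont hdiff hge 0
    (Set.left_mem_Icc.mpr zero_le_one) 1 (Set.right_mem_Icc.mpr zero_le_one) zero_le_one
  have hγ1 : γ 1 = qform (aeval B Q) w := by simp [hγ, hH]
  have hγ0 : γ 0 = qform (aeval A Q) w := by simp [hγ]
  rw [qform_sub, ← hγ1, ← hγ0]
  linarith

end LoewnerSufficiency

end Literature.Analysis.Complex

namespace Literature.Analysis.Complex

open scoped ComplexOrder MatrixOrder Matrix.Norms.L2Operator
open Set Filter Topology Polynomial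

/-! ### Matrix convexity -/

section ConvexAPI

variable {ι : Type*} [Fintype ι] [DecidableEq ι]

/-- Matrix convexity is independent of the index type. [folklore] -/
theorem IsMatrixConvexOn.posSemidef_of_fintype {f : ℝ → ℝ} {Δ : Set ℝ} (h : IsMatrixConvexOn f Δ)
    {A B : Matrix ι ι ℂ} (hA : A.IsHermitian) (hB : B.IsHermitian) (hAs : spectrum ℝ A ⊆ Δ)
    (hBs : spectrum ℝ B ⊆ Δ) {c : ℝ} (hc0 : 0 ≤ c) (hc1 : c ≤ 1)
    (hCs : spectrum ℝ ((c : ℂ) • A + ((1 - c : ℝ) : ℂ) • B) ⊆ Δ) :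
    ((c : ℂ) • cfc f A + ((1 - c : ℝ) : ℂ) • cfc f B -
      cfc f ((c : ℂ) • A + ((1 - c : ℝ) : ℂ) • B)).PosSemidef := by
  set e := Fintype.equivFin ι with he
  have hre : ∀ M : Matrix ι ι ℂ, M.IsHermitian → (Matrix.reindex e e M).IsHermitian := fun M hM => by
    unfold Matrix.IsHermitian; rw [Matrix.conjTranspose_reindex, hM]
  have hsp : ∀ M : Matrix ι ι ℂ, spectrum ℝ (Matrix.reindex e e M) = spectrum ℝ M := fun M => by
    rw [← Matrix.coe_reindexAlgEquiv ℝ ℂ e, AlgEquiv.spectrum_eq]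
  have hlin : ∀ (M N : Matrix ι ι ℂ) (a b : ℂ),
      a • Matrix.reindex e e M + b • Matrix.reindex e e N = Matrix.reindex e e (a • M + b • N) :=
    fun M N a b => rfl
  have hsub : ∀ M N : Matrix ι ι ℂ, Matrix.reindex e e M - Matrix.reindex e e N =
      Matrix.reindex e e (M - N) := fun M N => rfl
  have hC : ((c : ℂ) • A + ((1 - c : ℝ) : ℂ) • B).IsHermitian := by
    refine Matrix.IsHermitian.add ?_ ?_
    · rw [← real_smul_eq_coe_smul]
      exact (IsSelfAdjoint.smul (IsSelfAdjoint.all c) (hA : IsSelfAdjoint _) : IsSelfAdjoint _)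
    · rw [← real_smul_eq_coe_smul]
      exact (IsSelfAdjoint.smul (IsSelfAdjoint.all (1 - c)) (hB : IsSelfAdjoint _) : IsSelfAdjoint _)
  have key := h (Fintype.card ι) (Matrix.reindex e e A) (Matrix.reindex e e B) (hre A hA) (hre B hB)
    ((hsp A).symm ▸ hAs) ((hsp B).symm ▸ hBs) c hc0 hc1 (by rw [hlin, hsp]; exact hCs)
  rw [hlin, cfc_reindex' e f hA, cfc_reindex' e f hB, cfc_reindex' e f hC, hlin, hsub,
    Matrix.reindex_apply] at key
  exact (Matrix.posSemidef_submatrix_equiv e.symm).mp key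

/-- **Midpoint matrix convexity** in second-difference form:
`f(D + E) + f(D - E) - 2 f(D) ⪰ 0`. [folklore] -/
theorem IsMatrixConvexOn.second_difference_posSemidef {f : ℝ → ℝ} {Δ : Set ℝ}
    (h : IsMatrixConvexOn f Δ) {D E : Matrix ι ι ℂ} (hD : D.IsHermitian) (hE : E.IsHermitian)
    (hDs : spectrum ℝ D ⊆ Δ) (hpE : spectrum ℝ (D + E) ⊆ Δ) (hmE : spectrum ℝ (D - E) ⊆ Δ) :
    (cfc f (D + E) + cfc f (D - E) - (2 : ℂ) • cfc f D).PosSemidef := by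
  have hmid : (((1 / 2 : ℝ) : ℂ) • (D + E) + ((1 - 1 / 2 : ℝ) : ℂ) • (D - E)) = D := by
    push_cast; module
  have key := h.posSemidef_of_fintype (hD.add hE) (hD.sub hE) hpE hmE (c := 1 / 2) (by norm_num)
    (by norm_num) (by rw [hmid]; exact hDs)
  rw [hmid] at key
  have : cfc f (D + E) + cfc f (D - E) - (2 : ℂ) • cfc f D =
      (2 : ℂ) • (((1 / 2 : ℝ) : ℂ) • cfc f (D + E) + ((1 - 1 / 2 : ℝ) : ℂ) • cfc f (D - E) - cfc f D) := by
    push_cast; module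
  rw [this]
  exact key.smul (by norm_num)

/-- A Hermitian matrix is dominated by its entrywise size: `E ≤ entrySum E · 1` and
`-entrySum E · 1 ≤ E`. [folklore] -/
theorem posSemidef_entrySum_smul_one_sub {E : Matrix ι ι ℂ} (hE : E.IsHermitian) :
    (((entrySum E : ℝ) : ℂ) • (1 : Matrix ι ι ℂ) - E).PosSemidef ∧
      (E + ((entrySum E : ℝ) : ℂ) • (1 : Matrix ι ι ℂ)).PosSemidef := by
  have h1 : (((entrySum E : ℝ) : ℂ) • (1 : Matrix ι ι ℂ)).IsHermitian := by
    rw [← real_smul_eq_coe_smul]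
    exact (IsSelfAdjoint.smul (IsSelfAdjoint.all (entrySum E)) (IsSelfAdjoint.one (Matrix ι ι ℂ)) :
      IsSelfAdjoint _)
  constructor
  · rw [posSemidef_iff_qform (h1.sub hE)]
    intro w
    rw [qform_sub, qform_one_smul]
    linarith [qform_le E w]
  · rw [posSemidef_iff_qform (hE.add h1)]
    intro w
    rw [qform_add, qform_one_smul]
    linarith [neg_le_qform E w]

end ConvexAPI

end Literature.Analysis.Complex

namespace Literature.Analysis.Complex

open scoped ComplexOrder MatrixOrder Matrix.Norms.L2Operator
open Set Filter Topology Polynomial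

section Kraus

variable {ι : Type*} [Fintype ι] [DecidableEq ι]

omit [Fintype ι] [DecidableEq ι] in
/-- The border coupling matrix on `Option ι`: ones between `none` and `some _`. [folklore] -/
theorem border_apply_some_some (i j : ι) :
    (Matrix.of fun a b : Option ι => if (a.isSome ∧ b = none) ∨ (a = none ∧ b.isSome) then (1 : ℂ) else 0)
      (some i) (some j) = 0 := by simp

omit [Fintype ι] [DecidableEq ι] in
/-- Auxiliary for the proof of Loewner's theorem
(`border_apply_some_none`: border apply some none). [folklore] -/
theorem border_apply_some_none (i : ι) :
    (Matrix.of fun a b : Option ι => if (a.isSome ∧ b = none) ∨ (a = none ∧ b.isSome) then (1 : ℂ) else 0)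
      (some i) none = 1 := by simp

omit [Fintype ι] [DecidableEq ι] in
/-- Auxiliary for the proof of Loewner's theorem
(`border_apply_none_some`: border apply none some). [folklore] -/
theorem border_apply_none_some (j : ι) :
    (Matrix.of fun a b : Option ι => if (a.isSome ∧ b = none) ∨ (a = none ∧ b.isSome) then (1 : ℂ) else 0)
      none (some j) = 1 := by simp

omit [Fintype ι] [DecidableEq ι] in
/-- Auxiliary for the proof of Loewner's theorem
(`border_apply_none_none`: border apply none none). [folklore] -/
theorem border_apply_none_none :
    (Matrix.of fun a b : Option ι => if (a.isSome ∧ b = none) ∨ (a = none ∧ b.isSome) then (1 : ℂ) else 0)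
      none none = 0 := by simp

omit [Fintype ι] [DecidableEq ι] in
/-- Auxiliary for the proof of Loewner's theorem
(`border_isHermitian`: border isHermitian). [folklore] -/
theorem border_isHermitian :
    (Matrix.of fun a b : Option ι =>
      if (a.isSome ∧ b = none) ∨ (a = none ∧ b.isSome) then (1 : ℂ) else 0).IsHermitian := by
  ext a b
  rcases a with _ | i <;> rcases b with _ | j <;> simp [Matrix.conjTranspose_apply]

omit [Fintype ι] [DecidableEq ι] in
/-- Auxiliary for the proof of Loewner's theorem
(`norm_border_apply_le`: norm border apply le). [folklore] -/
theorem norm_border_apply_le (a b : Option ι) :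
    ‖(Matrix.of fun a b : Option ι =>
      if (a.isSome ∧ b = none) ∨ (a = none ∧ b.isSome) then (1 : ℂ) else 0) a b‖ ≤ 1 := by
  rw [Matrix.of_apply]; split_ifs <;> simp

omit [DecidableEq ι] in
/-- Quadratic forms of vectors supported away from the border. [folklore] -/
theorem qform_option_elim (M : Matrix (Option ι) (Option ι) ℂ) (w : ι → ℂ) :
    qform M (fun o => o.elim 0 w) = qform (Matrix.of fun i j => M (some i) (some j)) w := by
  simp only [qform, dotProduct, Matrix.mulVec, Fintype.sum_option, Option.elim, Pi.star_apply,
    star_zero, zero_mul, zero_add, mul_zero, Matrix.of_apply]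

omit [DecidableEq ι] in
/-- Auxiliary for the proof of Loewner's theorem
(`sum_norm_sq_option_elim`: sum norm sq option elim). [folklore] -/
theorem sum_norm_sq_option_elim (w : ι → ℂ) :
    ∑ o : Option ι, ‖(fun o => o.elim 0 w : Option ι → ℂ) o‖ ^ 2 = ∑ a, ‖w a‖ ^ 2 := by
  simp [Fintype.sum_option]

/-- **Kraus's necessary condition, quantitative slice** (Kraus 1936; Hiai–Petz Thm 4.40 uses it):
if `g` is matrix convex on `Δ ⊇ [c,d]`, `C²` on `[c,d]`, `0, t_i ∈ (c,d)`, and `Pp` is a real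
polynomial with `|Pp'' - g''| ≤ ε` on `[c,d]`, then the matrix of second divided differences
`(Pp[t_i, 0, t_j])_{ij}` is `⪰ -C ε` with `C = 4 n² (n+1)⁶`. Proof: second symmetric differences
of `g(D ± sH)` for the bordered diagonal `D = diag(t, 0)`, exact second-order expansion for the
polynomial part, Lemma A twice for the remainder. [folklore] -/
theorem kraus_qform_ge {g g' g'' : ℝ → ℝ} {Δ : Set ℝ} (hg : IsMatrixConvexOn g Δ) {c d : ℝ}
    (hΔ : Set.Icc c d ⊆ Δ) (hgd : ∀ x ∈ Set.Icc c d, HasDerivAt g (g' x) x)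
    (hg'd : ∀ x ∈ Set.Icc c d, HasDerivAt g' (g'' x) x) (h0 : (0 : ℝ) ∈ Set.Ioo c d)
    (t : ι → ℝ) (ht : ∀ i, t i ∈ Set.Ioo c d) {Pp : ℝ[X]} {ε : ℝ} (hε : 0 ≤ ε)
    (hPp : ∀ x ∈ Set.Icc c d, |Pp.derivative.derivative.eval x - g'' x| ≤ ε) (w : ι → ℂ) :
    -(4 * (Fintype.card ι : ℝ) ^ 2 * ((Fintype.card ι : ℝ) + 1) ^ 6 * ε * ∑ a, ‖w a‖ ^ 2) ≤
      qform (Matrix.of fun i j => (polyDD2 Pp (t i) 0 (t j) : ℂ)) w := by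
  -- the bordered data on `Option ι`
  set τ : Option ι → ℝ := fun o => o.elim 0 t with hτ
  have hτmem : ∀ o, τ o ∈ Set.Ioo c d := by rintro (_ | i); exacts [h0, ht i]
  set D : Matrix (Option ι) (Option ι) ℂ := Matrix.diagonal fun o => ((τ o : ℝ) : ℂ) with hD
  set H : Matrix (Option ι) (Option ι) ℂ := Matrix.of fun a b : Option ι =>
    if (a.isSome ∧ b = none) ∨ (a = none ∧ b.isSome) then (1 : ℂ) else 0 with hH
  have hDh : D.IsHermitian := Matrix.isHermitian_diagonal_of_self_adjoint _ (funext fun o => by simp)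
  have hHh : H.IsHermitian := border_isHermitian
  set n : ℕ := Fintype.card ι with hn
  have hcard : (Fintype.card (Option ι) : ℝ) = n + 1 := by rw [Fintype.card_option]; push_cast; rfl
  set eH : ℝ := entrySum H with heH
  have heH_le : eH ≤ 2 * n := by
    -- crude count: each entry has norm ≤ 1 and the diagonal blocks vanish
    have : eH = ∑ a : Option ι, ∑ b : Option ι, ‖H a b‖ := rfl
    rw [this, Fintype.sum_option]
    simp only [Fintype.sum_option, hH, border_apply_none_none, border_apply_none_some,
      border_apply_some_none, border_apply_some_some, norm_zero, norm_one, zero_add, add_zero,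
      Finset.sum_const, Finset.card_univ, nsmul_eq_mul, mul_one, mul_zero]
    rw [hn]; linarith
  have heH0 : 0 ≤ eH := entrySum_nonneg H
  -- margins and the admissible range of `s`
  set m : ℝ := (Finset.univ.inf' Finset.univ_nonempty fun o => min (τ o - c) (d - τ o)) with hm
  have hm0 : 0 < m := by
    obtain ⟨o, _, ho⟩ := Finset.exists_mem_eq_inf' Finset.univ_nonempty (fun o : Option ι => min (τ o - c) (d - τ o))
    rw [hm, ho]
    exact lt_min (by linarith [(hτmem o).1]) (by linarith [(hτmem o).2])
  have hmle : ∀ o, m ≤ τ o - c ∧ m ≤ d - τ o := fun o => by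
    have := Finset.inf'_le (fun o : Option ι => min (τ o - c) (d - τ o)) (Finset.mem_univ o)
    rw [← hm] at this
    exact ⟨this.trans (min_le_left _ _), this.trans (min_le_right _ _)⟩
  set s₀ : ℝ := m / (eH + 1) with hs₀
  have hs₀0 : 0 < s₀ := by positivity
  -- spectra
  have hspecD : spectrum ℝ D ⊆ Set.Icc c d := by
    rw [hD, spectrum_real_diagonal]; rintro _ ⟨o, rfl⟩; exact ⟨(hτmem o).1.le, (hτmem o).2.le⟩
  have hXh : ∀ s : ℝ, (D + (s : ℂ) • H).IsHermitian := fun s => by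
    refine hDh.add ?_
    rw [← real_smul_eq_coe_smul]
    exact (IsSelfAdjoint.smul (IsSelfAdjoint.all s) (hHh : IsSelfAdjoint _) : IsSelfAdjoint _)
  have hspecX : ∀ s : ℝ, |s| ≤ s₀ → spectrum ℝ (D + (s : ℂ) • H) ⊆ Set.Icc c d := by
    intro s hs
    have hsH : ((s : ℂ) • H).IsHermitian := by
      rw [← real_smul_eq_coe_smul]
      exact (IsSelfAdjoint.smul (IsSelfAdjoint.all s) (hHh : IsSelfAdjoint _) : IsSelfAdjoint _)
    obtain ⟨hup, hlow⟩ := posSemidef_entrySum_smul_one_sub hsH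
    have hes : entrySum ((s : ℂ) • H) = |s| * eH := by
      rw [entrySum_smul, Complex.norm_real, Real.norm_eq_abs]
    rw [hes] at hup hlow
    have hsm : |s| * eH ≤ m := by
      calc |s| * eH ≤ s₀ * eH := by gcongr
        _ = m * (eH / (eH + 1)) := by rw [hs₀]; ring
        _ ≤ m * 1 := by gcongr; rw [div_le_one (by positivity)]; linarith
        _ = m := mul_one m
    obtain ⟨hDc, hDd⟩ := le_and_le_of_spectrum_subset hDh (a := c + m) (b := d - m) (by
      rw [hD, spectrum_real_diagonal]; rintro _ ⟨o, rfl⟩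
      exact ⟨by linarith [(hmle o).1], by linarith [(hmle o).2]⟩)
    refine spectrum_subset_Icc_of_le_of_le (hXh s) ?_ ?_
    · have : D + (s : ℂ) • H - algebraMap ℝ _ c =
          (D - algebraMap ℝ _ (c + m)) + ((s : ℂ) • H + (((|s| * eH : ℝ)) : ℂ) • 1) +
            algebraMap ℝ _ (m - |s| * eH) := by
        simp only [Algebra.algebraMap_eq_smul_one, real_smul_eq_coe_smul]
        push_cast; module
      rw [this]
      refine (hDc.add hlow).add ?_
      rw [Algebra.algebraMap_eq_smul_one, real_smul_eq_coe_smul]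
      exact Matrix.PosSemidef.one.smul (by exact_mod_cast (sub_nonneg.mpr hsm))
    · have : algebraMap ℝ _ d - (D + (s : ℂ) • H) =
          (algebraMap ℝ _ (d - m) - D) + ((((|s| * eH : ℝ)) : ℂ) • 1 - (s : ℂ) • H) +
            algebraMap ℝ _ (m - |s| * eH) := by
        simp only [Algebra.algebraMap_eq_smul_one, real_smul_eq_coe_smul]
        push_cast; module
      rw [this]
      refine (hDd.add hup).add ?_
      rw [Algebra.algebraMap_eq_smul_one, real_smul_eq_coe_smul]
      exact Matrix.PosSemidef.one.smul (by exact_mod_cast (sub_nonneg.mpr hsm))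
  -- the remainder `φ = g - Pp` and its second-order bound
  set φ : ℝ → ℝ := fun x => g x - Pp.eval x with hφ
  set φ' : ℝ → ℝ := fun x => g' x - Pp.derivative.eval x with hφ'
  have hφd : ∀ x ∈ Set.Icc c d, HasDerivAt φ (φ' x) x := fun x hx =>
    (hgd x hx).sub (Pp.hasDerivAt x)
  have hφ'd : ∀ x ∈ Set.Icc c d, HasDerivAt φ' (g'' x - Pp.derivative.derivative.eval x) x :=
    fun x hx => (hg'd x hx).sub (Pp.derivative.hasDerivAt x)
  have hφ'b : ∀ x ∈ Set.Icc c d, |deriv φ' x| ≤ ε := by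
    intro x hx; rw [(hφ'd x hx).deriv, abs_sub_comm]; exact hPp x hx
  have hdd2 : ∀ x ∈ Set.Icc c d, ∀ y ∈ Set.Icc c d, ∀ z ∈ Set.Icc c d, |dd2 φ x y z| ≤ ε :=
    fun x hx y hy z hz => abs_dd2_le hφd (fun u hu => (hφ'd u hu).differentiableAt) hφ'b hx hy hz
  -- Step A: entrywise bound for the second difference of the remainder
  have hSDφ : ∀ s : ℝ, 0 < s → s ≤ s₀ →
      entrySum (cfc φ (D + (s : ℂ) • H) + cfc φ (D + ((-s : ℝ) : ℂ) • H) - (2 : ℂ) • cfc φ D) ≤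
        2 * ((n : ℝ) + 1) ^ 6 * eH ^ 2 * ε * s ^ 2 := by
    intro s hs0 hs1
    have hsp : |s| ≤ s₀ := by rwa [abs_of_pos hs0]
    have hsm : |(-s)| ≤ s₀ := by rwa [abs_neg, abs_of_pos hs0]
    set Xp := D + (s : ℂ) • H with hXp
    set Xm := D + ((-s : ℝ) : ℂ) • H with hXm
    have hcfcD : cfc φ D = Matrix.diagonal fun o => ((φ (τ o) : ℝ) : ℂ) := cfc_diagonal_real φ τ
    -- column-form differences
    have hentry : ∀ a b, (cfc φ Xp + cfc φ Xm - (2 : ℂ) • cfc φ D) a b =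
        (s : ℂ) * ((cfc (fun x => dd1 φ x (τ b)) Xp - cfc (fun x => dd1 φ x (τ b)) Xm) * H) a b := by
      intro a b
      have e1 := lemmaA_col (hXh s) τ φ (fun u v => dd1_mul_sub φ u v) a b
      have e2 := lemmaA_col (hXh (-s)) τ φ (fun u v => dd1_mul_sub φ u v) a b
      rw [← hD, ← hXp] at e1
      rw [← hD, ← hXm] at e2
      have hd1 : Xp - D = (s : ℂ) • H := by rw [hXp]; abel
      have hd2 : Xm - D = -((s : ℂ) • H) := by rw [hXm]; push_cast; module
      rw [hd1] at e1; rw [hd2] at e2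
      have hsplit : (cfc φ Xp + cfc φ Xm - (2 : ℂ) • cfc φ D) a b =
          (cfc φ Xp - cfc φ D) a b + (cfc φ Xm - cfc φ D) a b := by
        simp only [Matrix.add_apply, Matrix.sub_apply, Matrix.smul_apply, smul_eq_mul]; ring
      rw [hsplit, hcfcD, e1, e2]
      simp only [Matrix.mul_apply, Matrix.smul_apply, Matrix.neg_apply, smul_eq_mul, Matrix.sub_apply,
        Finset.mul_sum, ← Finset.sum_add_distrib]
      refine Finset.sum_congr rfl fun x _ => by ring
    -- bound each entry
    have hψbound : ∀ b, entrySum (cfc (fun x => dd1 φ x (τ b)) Xp - cfc (fun x => dd1 φ x (τ b)) Xm) ≤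
        ((n : ℝ) + 1) ^ 4 * ε * (2 * s * eH) := by
      intro b
      have hτb : τ b ∈ Set.Icc c d := ⟨(hτmem b).1.le, (hτmem b).2.le⟩
      have hev : ∀ i k, |dd2 φ ((hXh s).eigenvalues i) ((hXh (-s)).eigenvalues k) (τ b)| ≤ ε :=
        fun i k => hdd2 _ (hspecX s hsp ((hXh s).eigenvalues_mem_spectrum_real i)) _
          (hspecX (-s) hsm ((hXh (-s)).eigenvalues_mem_spectrum_real k)) _ hτb
      have := entrySum_cfc_sub_cfc_le (hXh s) (hXh (-s)) (fun x => dd1 φ x (τ b))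
        (fun u v => dd2_mul_sub φ u v (τ b)) hε hev
      rw [← hXp, ← hXm] at this
      refine this.trans (le_of_eq ?_)
      have hdiff : Xp - Xm = ((2 * s : ℝ) : ℂ) • H := by rw [hXp, hXm]; push_cast; module
      rw [hcard, hdiff, entrySum_smul, Complex.norm_real, Real.norm_eq_abs,
        abs_of_pos (by positivity), ← heH]
    calc entrySum (cfc φ Xp + cfc φ Xm - (2 : ℂ) • cfc φ D)
        = ∑ a, ∑ b, ‖(cfc φ Xp + cfc φ Xm - (2 : ℂ) • cfc φ D) a b‖ := rfl
      _ ≤ ∑ _a : Option ι, ∑ _b : Option ι, s * (((n : ℝ) + 1) ^ 4 * ε * (2 * s * eH) * eH) := by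
          refine Finset.sum_le_sum fun a _ => Finset.sum_le_sum fun b _ => ?_
          rw [hentry, norm_mul, Complex.norm_real, Real.norm_eq_abs, abs_of_pos hs0]
          refine mul_le_mul_of_nonneg_left ?_ hs0.le
          refine (norm_entry_le_entrySum _ a b).trans ((entrySum_mul_le _ _).trans ?_)
          rw [← heH]
          exact mul_le_mul_of_nonneg_right (hψbound b) heH0
      _ = (Fintype.card (Option ι) : ℝ) ^ 2 * (s * (((n : ℝ) + 1) ^ 4 * ε * (2 * s * eH) * eH)) := by
          simp only [Finset.sum_const, Finset.card_univ, nsmul_eq_mul]; ring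
      _ = 2 * ((n : ℝ) + 1) ^ 6 * eH ^ 2 * ε * s ^ 2 := by rw [hcard]; ring
  -- Step B: matrix convexity and the polynomial part
  set ŵ : Option ι → ℂ := fun o => o.elim 0 w with hŵ
  set W : ℝ := ∑ a, ‖w a‖ ^ 2 with hW
  have hWŵ : ∑ o, ‖ŵ o‖ ^ 2 = W := sum_norm_sq_option_elim w
  have hW0 : 0 ≤ W := Finset.sum_nonneg fun _ _ => by positivity
  have hpoly : ∀ s : ℝ, 0 < s → s ≤ s₀ →
      -(2 * ((n : ℝ) + 1) ^ 6 * eH ^ 2 * ε * W) ≤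
        qform (((s : ℂ) ^ 2)⁻¹ • (aeval (D + (s : ℂ) • H) Pp + aeval (D + ((-s : ℝ) : ℂ) • H) Pp -
          (2 : ℂ) • aeval D Pp)) ŵ := by
    intro s hs0 hs1
    have hsp : |s| ≤ s₀ := by rwa [abs_of_pos hs0]
    have hsm : |(-s)| ≤ s₀ := by rwa [abs_neg, abs_of_pos hs0]
    -- second difference of `g` is PSD
    have hE : ((s : ℂ) • H).IsHermitian := by
      rw [← real_smul_eq_coe_smul]
      exact (IsSelfAdjoint.smul (IsSelfAdjoint.all s) (hHh : IsSelfAdjoint _) : IsSelfAdjoint _)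
    have hSD := hg.second_difference_posSemidef hDh hE (hspecD.trans hΔ) ((hspecX s hsp).trans hΔ)
      (by
        have : D - (s : ℂ) • H = D + ((-s : ℝ) : ℂ) • H := by push_cast; module
        rw [this]; exact (hspecX (-s) hsm).trans hΔ)
    have hDm : D - (s : ℂ) • H = D + ((-s : ℝ) : ℂ) • H := by push_cast; module
    rw [hDm] at hSD
    have h0q := qform_nonneg_of_posSemidef hSD ŵ
    -- split into polynomial and remainder parts
    have hsplit : cfc g (D + (s : ℂ) • H) + cfc g (D + ((-s : ℝ) : ℂ) • H) - (2 : ℂ) • cfc g D =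
        (aeval (D + (s : ℂ) • H) Pp + aeval (D + ((-s : ℝ) : ℂ) • H) Pp - (2 : ℂ) • aeval D Pp) +
        (cfc φ (D + (s : ℂ) • H) + cfc φ (D + ((-s : ℝ) : ℂ) • H) - (2 : ℂ) • cfc φ D) := by
      rw [cfc_eq_aeval_add_cfc_sub (hXh s) g Pp, cfc_eq_aeval_add_cfc_sub (hXh (-s)) g Pp,
        cfc_eq_aeval_add_cfc_sub hDh g Pp]
      simp only [smul_add]; abel
    rw [hsplit, qform_add] at h0q
    have hrem : qform (cfc φ (D + (s : ℂ) • H) + cfc φ (D + ((-s : ℝ) : ℂ) • H) - (2 : ℂ) • cfc φ D) ŵ ≤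
        2 * ((n : ℝ) + 1) ^ 6 * eH ^ 2 * ε * s ^ 2 * W := by
      refine (qform_le _ ŵ).trans ?_
      rw [hWŵ]
      exact mul_le_mul_of_nonneg_right (hSDφ s hs0 hs1) hW0
    have hsc : ((s : ℂ) ^ 2)⁻¹ = (((s ^ 2)⁻¹ : ℝ) : ℂ) := by push_cast; rfl
    rw [hsc, qform_smul, le_inv_mul_iff₀ (by positivity)]
    nlinarith
  -- Step C: the limit `s → 0⁺`
  have hlim := tendsto_second_difference_aeval D H Pp
  have hlim' : Tendsto (fun s : ℝ => qform (((s : ℂ) ^ 2)⁻¹ • (aeval (D + (s : ℂ) • H) Pp +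
      aeval (D + ((-s : ℝ) : ℂ) • H) Pp - (2 : ℂ) • aeval D Pp)) ŵ) (𝓝[>] 0)
      (𝓝 (qform ((2 : ℂ) • polyCoeff D H Pp 2) ŵ)) :=
    ((continuous_qform ŵ).tendsto _).comp (hlim.mono_left (nhdsWithin_mono _ fun s hs => ne_of_gt hs))
  have hev : ∀ᶠ (s : ℝ) in 𝓝[>] (0 : ℝ), -(2 * ((n : ℝ) + 1) ^ 6 * eH ^ 2 * ε * W) ≤
      qform (((s : ℂ) ^ 2)⁻¹ • (aeval (D + (s : ℂ) • H) Pp + aeval (D + ((-s : ℝ) : ℂ) • H) Pp -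
        (2 : ℂ) • aeval D Pp)) ŵ := by
    filter_upwards [Ioo_mem_nhdsGT hs₀0] with s hs
    exact hpoly s hs.1 hs.2.le
  have hpc := ge_of_tendsto hlim' hev
  -- Step D: identify the block of `2 polyCoeff₂` with the Kraus matrix
  have hblock : qform ((2 : ℂ) • polyCoeff D H Pp 2) ŵ =
      2 * qform (Matrix.of fun i j => (polyDD2 Pp (t i) 0 (t j) : ℂ)) w := by
    rw [show ((2 : ℂ)) = ((2 : ℝ) : ℂ) by norm_num, qform_smul, hŵ, qform_option_elim]
    congr 2
    ext i j
    rw [Matrix.of_apply, Matrix.of_apply, hD, polyCoeff_two_apply, Fintype.sum_option]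
    simp only [hH, border_apply_some_none, border_apply_none_some, border_apply_some_some,
      mul_one, mul_zero, Finset.sum_const_zero, add_zero]
    rfl
  rw [hblock] at hpc
  have hfin : -(((n : ℝ) + 1) ^ 6 * eH ^ 2 * ε * W) ≤
      qform (Matrix.of fun i j => (polyDD2 Pp (t i) 0 (t j) : ℂ)) w := by linarith
  refine le_trans ?_ hfin
  rw [neg_le_neg_iff]
  have : eH ^ 2 ≤ (2 * n) ^ 2 := by gcongr
  calc ((n : ℝ) + 1) ^ 6 * eH ^ 2 * ε * W ≤ ((n : ℝ) + 1) ^ 6 * (2 * n) ^ 2 * ε * W := by gcongr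
    _ = 4 * (n : ℝ) ^ 2 * ((n : ℝ) + 1) ^ 6 * ε * W := by ring

end Kraus

end Literature.Analysis.Complex
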